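import Literature.Topology.FourManifolds.MMSWRasmussenFacts
import Literature.Topology.FourManifolds.MMSWModelBoundaryRegular
import Summits.SmoothPoincare4.SmoothPoincare4.Theses.DottedCircleRasmussen

/-!
# Helper `helper_friendsCarrier_guardInactive` of stub `stub_friendsCarrier` (line `mk_friends`, crux `DcrGap`)
(item stmt-SmoothPoincare4-16128, route route-SmoothPoincare4-DottedCircleRasmussen)

**The honest-division guard is inactive on the model handlebody.**  The model dotted handlebody of the
route is `D_k = {x | (∀ j, 1 ≤ |z - c_j|²) ∧ G_k(x) ≤ 1}` (`MMSW.modelHandlebody`), the guard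
`1 ≤ |z - c_j|²` excluding the poles `z = c_j` of the level function
`G_k = |z|²/(40(k+1))² + Σ_j 1/|z - c_j|² + |w|²` (where Lean's `1/0 = 0` would otherwise let spurious
points in).  This file proves that the guard never binds: on `D_k` every hole term is STRICTLY larger
than `1` (if `|z - c_j|² = 1` then the `j`-th term of `G_k` alone is `1`, forcing `z = 0`, but then
`|z - c_j|² = 16(j+1)² ≥ 16`), so that on the OPEN set `V_k = {∀ j, 1 < |z - c_j|²} ⊇ D_k` the handlebody
is literally the sublevel set `{G_k ≤ 1}`, its boundary `M_k` the level set `{G_k = 1}`, and `G_k` is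
`C^∞` — the form in which the collar / regular-level arguments of the carrier construction
(stub `stub_friendsCarrier`, clause "core disc leaves `D_k` transversally": `d/dρ G_k(g₀(ρ t))|₁ < 0`)
consume the model, together with the landed regularity `MMSW.fderiv_levelFun_ne_zero`
(`MMSWModelBoundaryRegular.lean`: `1` is a regular value of `G_k` along `M_k`).

* `one_lt_holeTerm_of_mem_modelHandlebody` — the strict guard on `D_k`;
* `helper_friendsCarrier_guardInactive` — the packaged statement (open `V_k ⊇ D_k`; on `V_k`:
  `x ∈ D_k ↔ G_k x ≤ 1`, `x ∈ M_k ↔ G_k x = 1`, `G_k` smooth at `x`; `dG_k ≠ 0` on `M_k`).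

No definitions, no named facts, no `sorry`.
-/

-- the prescribed namespace `Summit.<P>.<Sub>.…` duplicates `SmoothPoincare4` (P = Sub)
set_option linter.dupNamespace false
set_option linter.style.longLine false

noncomputable section

open scoped Manifold ContDiff Topology
open Function Set Metric
open Literature.Topology.FourManifolds Literature.Topology.FourManifolds.MMSW

namespace Summit.SmoothPoincare4.SmoothPoincare4.Theorems.DcrGap.MkFriends

/-- **The guard is strict on `D_k`.**  If `x ∈ D_k` then `1 < |z - c_j|²` for every hole `j`: were
`|z - c_j|² = 1`, the `j`-th term `1/|z - c_j|²` of `G_k(x) ≤ 1` would already be `1`, forcing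
`|z|² = 0`, i.e. `z = 0`, whence `|z - c_j|² = (4(j+1))² ≥ 16`. [folklore] -/
theorem one_lt_holeTerm_of_mem_modelHandlebody {k : ℕ} {x : EuclideanSpace ℝ (Fin 4)}
    (hx : x ∈ modelHandlebody k) (j : Fin k) : 1 < holeTerm k j x := by
  obtain ⟨hg, hle⟩ := hx
  refine lt_of_le_of_ne (hg j) fun h1 => ?_
  -- the `j`-th term of the level function is `1`
  have hterm : ∑ i : Fin k, 1 / holeTerm k i x = 1 + ∑ i ∈ Finset.univ.erase j, 1 / holeTerm k i x := by
    rw [← Finset.add_sum_erase _ _ (Finset.mem_univ j), ← h1, div_one]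
  have hrest : 0 ≤ ∑ i ∈ Finset.univ.erase j, 1 / holeTerm k i x :=
    Finset.sum_nonneg fun i _ => by have := hg i; positivity
  have hR : (0 : ℝ) < (40 * ((k : ℝ) + 1)) ^ 2 := by positivity
  have hz : ((x 0) ^ 2 + (x 1) ^ 2) / (40 * ((k : ℝ) + 1)) ^ 2 ≤ 0 := by
    unfold levelFun at hle
    rw [hterm] at hle
    nlinarith [sq_nonneg (x 2), sq_nonneg (x 3)]
  have hz' : (x 0) ^ 2 + (x 1) ^ 2 ≤ 0 := by
    rwa [div_nonpos_iff, or_iff_right (not_and_of_not_right _ (not_le.2 hR)), and_iff_left hR.le] at hz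
  have h0 : x 0 = 0 := by nlinarith [sq_nonneg (x 0), sq_nonneg (x 1)]
  have h1' : x 1 = 0 := by nlinarith [sq_nonneg (x 0), sq_nonneg (x 1)]
  have hj : (1 : ℝ) ≤ ((j : ℕ) : ℝ) + 1 := by
    have : (0 : ℝ) ≤ ((j : ℕ) : ℝ) := Nat.cast_nonneg _
    linarith
  unfold holeTerm at h1
  rw [h0, h1'] at h1
  nlinarith

/-- The open strict-guard set `V_k = {∀ j, 1 < |z - c_j|²}` contains `D_k`. [folklore] -/
theorem modelHandlebody_subset_strictGuard (k : ℕ) :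
    modelHandlebody k ⊆ {x : EuclideanSpace ℝ (Fin 4) | ∀ j : Fin k, 1 < holeTerm k j x} :=
  fun _ hx j => one_lt_holeTerm_of_mem_modelHandlebody hx j

/-- **Helper `helper_friendsCarrier_guardInactive`** (registered on the crux item; model bookkeeping for
the collar clause of stub `stub_friendsCarrier`).  For every `k`: the strict-guard set
`V_k = {x | ∀ j, 1 < |z - c_j|²}` is open and contains the model handlebody `D_k`; on `V_k` the
handlebody is the sublevel set `{G_k ≤ 1}`, the model boundary `M_k` is the level set `{G_k = 1}`, and
`G_k` is `C^∞`; and `dG_k ≠ 0` at every point of `M_k` (`1` is a regular value along `M_k`, the landed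
`MMSW.fderiv_levelFun_ne_zero`). [cite: HirschDT1976, Ch. 1 Thm. 3.2] -/
theorem helper_friendsCarrier_guardInactive : ∀ (k : ℕ), IsOpen {x : EuclideanSpace ℝ (Fin 4) | ∀ j : Fin k, 1 < Literature.Topology.FourManifolds.MMSW.holeTerm k j x} ∧ Literature.Topology.FourManifolds.MMSW.modelHandlebody k ⊆ {x : EuclideanSpace ℝ (Fin 4) | ∀ j : Fin k, 1 < Literature.Topology.FourManifolds.MMSW.holeTerm k j x} ∧ (∀ x ∈ {x : EuclideanSpace ℝ (Fin 4) | ∀ j : Fin k, 1 < Literature.Topology.FourManifolds.MMSW.holeTerm k j x}, (x ∈ Literature.Topology.FourManifolds.MMSW.modelHandlebody k ↔ Literature.Topology.FourManifolds.MMSW.levelFun k x ≤ 1) ∧ (x ∈ Literature.Topology.FourManifolds.MMSW.modelBoundary k ↔ Literature.Topology.FourManifolds.MMSW.levelFun k x = 1) ∧ ContDiffAt ℝ ((⊤ : ℕ∞) : WithTop ℕ∞) (Literature.Topology.FourManifolds.MMSW.levelFun k) x) ∧ ∀ x ∈ Literature.Topology.FourManifolds.MMSW.modelBoundary k, fderiv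 ℝ (Literature.Topology.FourManifolds.MMSW.levelFun k) x ≠ 0 := by
  intro k
  refine ⟨isOpen_guard 1, modelHandlebody_subset_strictGuard k, fun x hx => ⟨?_, ?_, ?_⟩,
    fun x hx => fderiv_levelFun_ne_zero hx⟩
  · exact ⟨fun h => h.2, fun h => ⟨fun j => (hx j).le, h⟩⟩
  · exact ⟨fun h => h.2, fun h => ⟨fun j => (hx j).le, h⟩⟩
  · exact contDiffAt_levelFun fun j => (one_pos.trans (hx j)).ne'

end Summit.SmoothPoincare4.SmoothPoincare4.Theorems.DcrGap.MkFriends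

end
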